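import Mathlib
import Summits.KontsevichZagierPeriods.Zeta5Search.FamilyCellDAtlasNotMin
import Summits.KontsevichZagierPeriods.Zeta5Search.RecordCellDDigits
import HarnessLib

/-!
# ζ(5) search — FAMILY CELL D, digit layer: the minimal classes of `n·(3t+8; t+6,…,t)` at `(t+3)n < 2p < (t+4)n`

Cell `pub-zeta5` (HONEST FRAMING: systematic search; no irrationality claim unless certified), P1 prover seat
generation 6; part 1 of the Lean proof of census g11's `CellAtlas.FamilyCellD` (assembly in `FamilyCellDProof.lean`), the
`t`-uniform version of `RecordCellDDigits` (`m = tn`, `N = 3m + 8n`).  `digits_of_level` is the general statement behind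
both: for ANY parameter vector `b′` (`b′₀ = N`) and any centre-free level class `{x,…,x+Lp}` of a type `e` with `E(e) = −8`
the normalised digits are `p⁵W_x ≡ −g·ŵ(e)`, `p⁸V_x ≡ g·v̂(e) (mod p)` for every `g ≡ ĝ_x`, and the conjugate class
`N − (x+Lp)` carries the unit `−ĝ_x` (`LevelClassDigits` + G1/G2).  Packages: `packT1F` (a `FMinT1/FMinT2` pair contributes
`ĝ_x·(−α, β)` with the record's symbolic constants `alphaD`, `betaD`), `packSF` and — new — `packPF` (the pair sums of the
palindromic five-point `FMinS` and six-point `FMinP` classes VANISH modulo `p`, gen-2 g9's COROLLARY P(a)).  The type constants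
are never evaluated.  `p`-adic valuations of rational numbers; nothing about irrationality.  Exact cross-check at 8 instances
`t ∈ {10,…,17}`: `code/p1/g6/famD_check.py`.
-/

noncomputable section

open Finset

namespace Summit.KontsevichZagierPeriods.Zeta5Search.CellD

open Summit.KontsevichZagierPeriods.Zeta5Search.DualSeries (InBox)
open Summit.KontsevichZagierPeriods.Zeta5Search.WedgeDictionary (pfData coeffW coeffV)
open Summit.KontsevichZagierPeriods.Zeta5Search.CasoratianValuation (InPolytope shift casoratian)
open Summit.KontsevichZagierPeriods.Zeta5Search.ClusterValuation
open Summit.KontsevichZagierPeriods.Zeta5Search.PadicSeries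
open Summit.KontsevichZagierPeriods.Zeta5Search.BigPrime (shift_zero padicNorm_mul_le_one)
open Summit.KontsevichZagierPeriods.Zeta5Search.CellAtlas (bFam)
open Summit.KontsevichZagierPeriods.Zeta5Search.CellA
open Summit.KontsevichZagierPeriods.Zeta5Search.LevelClass

variable {p : ℕ} [hp : Fact p.Prime]

/-! ### §1 The six-point palindromic type -/

/-- The six-point palindromic type `P = (1,1,−6,−6,1,1)`. -/
def eP6 : ℕ → ℤ
  | 0 => 1 | 1 => 1 | 2 => -6 | 3 => -6 | 4 => 1 | 5 => 1 | _ => 0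

/-- `E(P) = −8`. -/
theorem typeExp_eP6 : typeExp 5 eP6 = -8 := by decide

omit hp in
/-- Six point values as a level exponent vector. -/
theorem he_of_six {b : ℕ → ℤ} {x : ℕ} {e : ℕ → ℤ} (h0 : netExp b x = e 0) (h1 : netExp b (x + p) = e 1)
    (h2 : netExp b (x + 2 * p) = e 2) (h3 : netExp b (x + 3 * p) = e 3) (h4 : netExp b (x + 4 * p) = e 4)
    (h5 : netExp b (x + 5 * p) = e 5) : ∀ k ≤ 5, netExp b (x + k * p) = e k := by
  intro k hk
  interval_cases k
  · simpa using h0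
  · simpa using h1
  · exact h2
  · exact h3
  · exact h4
  · exact h5

/-! ### §2 The digits of one minimal level class of class exponent `−8` -/

/-- **The digits of ONE centre-free level class `{x,…,x+Lp}` of a type `e` with `E(e) = −8`** (any `b′` with `b′₀ = N`):
`‖p⁵W_x + g·ŵ(e)‖ ≤ p⁻¹`, `‖p⁸V_x − g·v̂(e)‖ ≤ p⁻¹` for any `g ≡ ĝ_x`, the integrality of `ŵ(e)`, `v̂(e)`, `ĝ_x`, and the
conjugate unit `‖ĝ_{N−(x+Lp)} + ĝ_x‖ ≤ p⁻¹`. -/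
theorem digits_of_level (hp5 : 5 ≤ p) (b : ℕ → ℤ) (hb : InPolytope b) (hwin : (b 0 + 2 : ℤ) < (p : ℤ) ^ 2) {N : ℕ}
    (hN : (b 0).toNat = N) {x L : ℕ} (hx : x < p) (hL : x + L * p ≤ N) (hL' : N < x + L * p + p)
    (hc : ¬ CentreIn b p x) {e : ℕ → ℤ} (hE : typeExp L e = -8) {i₀ : ℕ} (hi₀ : i₀ ≤ L) (hneg : e i₀ < 0)
    (he : ∀ k ≤ L, netExp b (x + k * p) = e k) {g : ℚ} (hg : padicNorm p (gHat b p x - g) ≤ (p : ℚ) ^ (-(1 : ℤ))) :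
    padicNorm p ((p : ℚ) ^ 5 * classW b p x + g * typeW L e) ≤ (p : ℚ) ^ (-(1 : ℤ)) ∧
    padicNorm p ((p : ℚ) ^ 8 * classV b p x - g * typeV L e) ≤ (p : ℚ) ^ (-(1 : ℤ)) ∧
    padicNorm p (typeW L e) ≤ 1 ∧ padicNorm p (typeV L e) ≤ 1 ∧ padicNorm p (gHat b p x) ≤ 1 ∧
    padicNorm p (gHat b p (N - (x + L * p)) + gHat b p x) ≤ (p : ℚ) ^ (-(1 : ℤ)) := by
  obtain ⟨hbox, -, -, hn⟩ := thmA_data b hb hwin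
  have hp2 : p ≠ 2 := by omega
  have hL1 : x + L * p ≤ (b 0).toNat := by rw [hN]; exact hL
  have hL2 : (b 0).toNat < x + L * p + p := by rw [hN]; exact hL'
  have hx0 : x ∈ classSet b p x := by simpa using level_mem b hx hL1 hL2 (Nat.zero_le L)
  have hw := w_digit_level b hx hL1 hL2 hb hp5 hwin e he hc hi₀ hneg hg
  have hv := v_digit_level b hx hL1 hL2 hb hp5 hwin e he hc hi₀ hneg hg
  have hgc := gHat_conj_level b hx hL1 hL2 hb hp5 e he hc
  rw [hE] at hw hv hgc
  rw [negp_zpow_five, show -(p : ℚ) ^ 5 * classW b p x - g * typeW L e = -((p : ℚ) ^ 5 * classW b p x + g * typeW L e)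
    by ring, padicNorm.neg] at hw
  rw [negp_zpow_eight] at hv
  rw [neg_one_zpow_m7, neg_one_mul, sub_neg_eq_add, hN] at hgc
  refine ⟨hw, hv, ?_, ?_, padicNorm_gHat_le_one b hb hp5 hx hx0, hgc⟩
  · rw [← wHat_level b hx hL1 hL2 e he hc]
    exact padicNorm_wHat_le_one b hbox.1 hn hp2 x
  · rw [← vHat_level b hx hL1 hL2 e he hc]
    exact padicNorm_vHat_le_one b hbox.1 hn hp2

/-! ### §3 The minimal classes of the family for any `b′` with the family class data (`b′ = b` or `b + e₇`) -/

section MinBlock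

variable {t n : ℕ} (ht : 10 ≤ t) (hp14 : t * n + 3 * n < 2 * p) (hp15 : 2 * p < t * n + 4 * n) (hp5 : 5 ≤ p)
  (b : ℕ → ℤ) (hb : InPolytope b) (hwin : (b 0 + 2 : ℤ) < (p : ℤ) ^ 2) (hN : (b 0).toNat = 3 * (t * n) + 8 * n)
  (hcen : ∀ x, x < p → 2 * x + 4 * p ≠ 3 * (t * n) + 8 * n → 2 * x + 5 * p ≠ 3 * (t * n) + 8 * n → ¬ CentreIn b p x)
  (hT1 : ∀ x ∈ FMinT1 t n p, netExp b x = 1 ∧ netExp b (x + p) = -1 ∧ netExp b (x + 2 * p) = -6 ∧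
      netExp b (x + 3 * p) = -3 ∧ netExp b (x + 4 * p) = 1)
  (hS : ∀ x ∈ FMinS t n p, netExp b x = 1 ∧ netExp b (x + p) = -2 ∧ netExp b (x + 2 * p) = -6 ∧
      netExp b (x + 3 * p) = -2 ∧ netExp b (x + 4 * p) = 1)
  (hT2 : ∀ x ∈ FMinT2 t n p, netExp b x = 1 ∧ netExp b (x + p) = -3 ∧ netExp b (x + 2 * p) = -6 ∧
      netExp b (x + 3 * p) = -1 ∧ netExp b (x + 4 * p) = 1)
  (hP : ∀ x ∈ FMinP t n p, netExp b x = 1 ∧ netExp b (x + p) = 1 ∧ netExp b (x + 2 * p) = -6 ∧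
      netExp b (x + 3 * p) = -6 ∧ netExp b (x + 4 * p) = 1 ∧ netExp b (x + 5 * p) = 1)

include ht hp14 hp15 hp5 hb hwin hN hcen hT1 hT2 in
/-- **The digit package of a `FMinT1`/`FMinT2` pair** `x`, `x̄ = N − (x+4p)`: `p⁵(W_x + W_x̄) ≡ −α·ĝ_x`,
`p⁸(V_x + V_x̄) ≡ β·ĝ_x (mod p)` with the record's constants `alphaD`, `betaD`; integrality of the pieces, of `α`, of `ĝ_x`. -/
theorem packT1F {x : ℕ} (hx : x ∈ FMinT1 t n p) :
    padicNorm p ((p : ℚ) ^ 5 * (classW b p x + classW b p (3 * (t * n) + 8 * n - (x + 4 * p))) + alphaD * gHat b p x) ≤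
      (p : ℚ) ^ (-(1 : ℤ)) ∧
    padicNorm p ((p : ℚ) ^ 8 * (classV b p x + classV b p (3 * (t * n) + 8 * n - (x + 4 * p))) - betaD * gHat b p x) ≤
      (p : ℚ) ^ (-(1 : ℤ)) ∧
    padicNorm p ((p : ℚ) ^ 5 * classW b p x) ≤ 1 ∧ padicNorm p ((p : ℚ) ^ 8 * classV b p x) ≤ 1 ∧
    padicNorm p ((p : ℚ) ^ 5 * classW b p (3 * (t * n) + 8 * n - (x + 4 * p))) ≤ 1 ∧
    padicNorm p ((p : ℚ) ^ 8 * classV b p (3 * (t * n) + 8 * n - (x + 4 * p))) ≤ 1 ∧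
    padicNorm p alphaD ≤ 1 ∧ padicNorm p (gHat b p x) ≤ 1 := by
  have h10 : 10 * n ≤ t * n := Nat.mul_le_mul_right n ht
  have hx' := conj_mem_fminT2 hx
  obtain ⟨e0, e1, e2, e3, e4⟩ := hT1 x hx
  obtain ⟨f0, f1, f2, f3, f4⟩ := hT2 _ hx'
  rw [mem_fminT1] at hx
  obtain ⟨hxp, h12, h27, h41⟩ := hx
  set g := gHat b p x with hgdef
  have hg0 : padicNorm p (gHat b p x - g) ≤ (p : ℚ) ^ (-(1 : ℤ)) := by
    rw [hgdef, sub_self, padicNorm.zero]; exact zpow_p_nonneg _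
  obtain ⟨w1, v1, iw1, iv1, ig, hconj⟩ := digits_of_level hp5 b hb hwin hN hxp (L := 4) (by omega) (by omega)
    (hcen x hxp (by omega) (by omega)) typeExp_eT1 (i₀ := 2) (by norm_num) (by decide) (he_of_five e0 e1 e2 e3 e4) hg0
  have hg1 : padicNorm p (gHat b p (3 * (t * n) + 8 * n - (x + 4 * p)) - (-g)) ≤ (p : ℚ) ^ (-(1 : ℤ)) := by
    rw [sub_neg_eq_add]; exact hconj
  obtain ⟨w2, v2, iw2, iv2, -, -⟩ := digits_of_level hp5 b hb hwin hN (x := 3 * (t * n) + 8 * n - (x + 4 * p)) (L := 4)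
    (by omega) (by omega) (by omega) (hcen _ (by omega) (by omega) (by omega)) typeExp_eT2 (i₀ := 2) (by norm_num)
    (by decide) (he_of_five f0 f1 f2 f3 f4) hg1
  refine ⟨?_, ?_, ?_, ?_, ?_, ?_, nI_sub iw1 iw2, ig⟩
  · have e : (p : ℚ) ^ 5 * (classW b p x + classW b p (3 * (t * n) + 8 * n - (x + 4 * p))) + alphaD * gHat b p x =
        ((p : ℚ) ^ 5 * classW b p x + g * typeW 4 eT1) +
          ((p : ℚ) ^ 5 * classW b p (3 * (t * n) + 8 * n - (x + 4 * p)) + (-g) * typeW 4 eT2) := by rw [alphaD]; ring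
    rw [e]; exact small_add w1 w2
  · have e : (p : ℚ) ^ 8 * (classV b p x + classV b p (3 * (t * n) + 8 * n - (x + 4 * p))) - betaD * gHat b p x =
        ((p : ℚ) ^ 8 * classV b p x - g * typeV 4 eT1) +
          ((p : ℚ) ^ 8 * classV b p (3 * (t * n) + 8 * n - (x + 4 * p)) - (-g) * typeV 4 eT2) := by rw [betaD]; ring
    rw [e]; exact small_add v1 v2
  · have e : (p : ℚ) ^ 5 * classW b p x = ((p : ℚ) ^ 5 * classW b p x + g * typeW 4 eT1) - g * typeW 4 eT1 := by ring
    rw [e]; exact nI_sub (nI_of_small w1) (padicNorm_mul_le_one ig iw1)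
  · have e : (p : ℚ) ^ 8 * classV b p x = ((p : ℚ) ^ 8 * classV b p x - g * typeV 4 eT1) + g * typeV 4 eT1 := by ring
    rw [e]; exact nI_add (nI_of_small v1) (padicNorm_mul_le_one ig iv1)
  · have e : (p : ℚ) ^ 5 * classW b p (3 * (t * n) + 8 * n - (x + 4 * p)) =
        ((p : ℚ) ^ 5 * classW b p (3 * (t * n) + 8 * n - (x + 4 * p)) + (-g) * typeW 4 eT2) + g * typeW 4 eT2 := by ring
    rw [e]; exact nI_add (nI_of_small w2) (padicNorm_mul_le_one ig iw2)
  · have e : (p : ℚ) ^ 8 * classV b p (3 * (t * n) + 8 * n - (x + 4 * p)) =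
        ((p : ℚ) ^ 8 * classV b p (3 * (t * n) + 8 * n - (x + 4 * p)) - (-g) * typeV 4 eT2) - g * typeV 4 eT2 := by ring
    rw [e]; exact nI_sub (nI_of_small v2) (padicNorm_mul_le_one ig iv2)

include ht hp14 hp15 hp5 hb hwin hN hcen hS in
/-- **The digit package of a `FMinS` pair** `x`, `x̄ = N − (x+4p)`: the pair sums vanish modulo `p`; integrality. -/
theorem packSF {x : ℕ} (hx : x ∈ FMinS t n p) :
    padicNorm p ((p : ℚ) ^ 5 * (classW b p x + classW b p (3 * (t * n) + 8 * n - (x + 4 * p)))) ≤ (p : ℚ) ^ (-(1 : ℤ)) ∧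
    padicNorm p ((p : ℚ) ^ 8 * (classV b p x + classV b p (3 * (t * n) + 8 * n - (x + 4 * p)))) ≤ (p : ℚ) ^ (-(1 : ℤ)) ∧
    padicNorm p ((p : ℚ) ^ 5 * classW b p x) ≤ 1 ∧ padicNorm p ((p : ℚ) ^ 8 * classV b p x) ≤ 1 := by
  have h10 : 10 * n ≤ t * n := Nat.mul_le_mul_right n ht
  have hx' := conj_mem_fminSD hp14 hx
  obtain ⟨e0, e1, e2, e3, e4⟩ := hS x hx
  obtain ⟨f0, f1, f2, f3, f4⟩ := hS _ hx'
  rw [mem_fminS'] at hx hx'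
  obtain ⟨hxp, h13, h28, hself⟩ := hx
  set g := gHat b p x with hgdef
  have hg0 : padicNorm p (gHat b p x - g) ≤ (p : ℚ) ^ (-(1 : ℤ)) := by
    rw [hgdef, sub_self, padicNorm.zero]; exact zpow_p_nonneg _
  obtain ⟨w1, v1, iw1, iv1, ig, hconj⟩ := digits_of_level hp5 b hb hwin hN hxp (L := 4) (by omega) (by omega)
    (hcen x hxp hself (by omega)) typeExp_eS (i₀ := 2) (by norm_num) (by decide) (he_of_five e0 e1 e2 e3 e4) hg0
  have hg1 : padicNorm p (gHat b p (3 * (t * n) + 8 * n - (x + 4 * p)) - (-g)) ≤ (p : ℚ) ^ (-(1 : ℤ)) := by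
    rw [sub_neg_eq_add]; exact hconj
  obtain ⟨w2, v2, -, -, -, -⟩ := digits_of_level hp5 b hb hwin hN (x := 3 * (t * n) + 8 * n - (x + 4 * p)) (L := 4)
    (by omega) (by omega) (by omega) (hcen _ (by omega) hx'.2.2.2 (by omega)) typeExp_eS (i₀ := 2) (by norm_num)
    (by decide) (he_of_five f0 f1 f2 f3 f4) hg1
  refine ⟨?_, ?_, ?_, ?_⟩
  · have e : (p : ℚ) ^ 5 * (classW b p x + classW b p (3 * (t * n) + 8 * n - (x + 4 * p))) =
        ((p : ℚ) ^ 5 * classW b p x + g * typeW 4 eS) +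
          ((p : ℚ) ^ 5 * classW b p (3 * (t * n) + 8 * n - (x + 4 * p)) + (-g) * typeW 4 eS) := by ring
    rw [e]; exact small_add w1 w2
  · have e : (p : ℚ) ^ 8 * (classV b p x + classV b p (3 * (t * n) + 8 * n - (x + 4 * p))) =
        ((p : ℚ) ^ 8 * classV b p x - g * typeV 4 eS) +
          ((p : ℚ) ^ 8 * classV b p (3 * (t * n) + 8 * n - (x + 4 * p)) - (-g) * typeV 4 eS) := by ring
    rw [e]; exact small_add v1 v2
  · have e : (p : ℚ) ^ 5 * classW b p x = ((p : ℚ) ^ 5 * classW b p x + g * typeW 4 eS) - g * typeW 4 eS := by ring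
    rw [e]; exact nI_sub (nI_of_small w1) (padicNorm_mul_le_one ig iw1)
  · have e : (p : ℚ) ^ 8 * classV b p x = ((p : ℚ) ^ 8 * classV b p x - g * typeV 4 eS) + g * typeV 4 eS := by ring
    rw [e]; exact nI_add (nI_of_small v1) (padicNorm_mul_le_one ig iv1)

include ht hp14 hp15 hp5 hb hwin hN hcen hP in
/-- **The digit package of a six-point `FMinP` pair** `x`, `x̄ = N − (x+5p)` (both of the palindromic type `P`): the pair
sums `p⁵(W_x + W_x̄)`, `p⁸(V_x + V_x̄)` VANISH modulo `p`; integrality. -/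
theorem packPF {x : ℕ} (hx : x ∈ FMinP t n p) :
    padicNorm p ((p : ℚ) ^ 5 * (classW b p x + classW b p (3 * (t * n) + 8 * n - (x + 5 * p)))) ≤ (p : ℚ) ^ (-(1 : ℤ)) ∧
    padicNorm p ((p : ℚ) ^ 8 * (classV b p x + classV b p (3 * (t * n) + 8 * n - (x + 5 * p)))) ≤ (p : ℚ) ^ (-(1 : ℤ)) ∧
    padicNorm p ((p : ℚ) ^ 5 * classW b p x) ≤ 1 ∧ padicNorm p ((p : ℚ) ^ 8 * classV b p x) ≤ 1 := by
  have h10 : 10 * n ≤ t * n := Nat.mul_le_mul_right n ht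
  have hx' := conj_mem_fminP hp14 hp15 hx
  obtain ⟨e0, e1, e2, e3, e4, e5⟩ := hP x hx
  obtain ⟨f0, f1, f2, f3, f4, f5⟩ := hP _ hx'
  rw [mem_fminP] at hx hx'
  obtain ⟨hxp, h17, h24, hself⟩ := hx
  set g := gHat b p x with hgdef
  have hg0 : padicNorm p (gHat b p x - g) ≤ (p : ℚ) ^ (-(1 : ℤ)) := by
    rw [hgdef, sub_self, padicNorm.zero]; exact zpow_p_nonneg _
  obtain ⟨w1, v1, iw1, iv1, ig, hconj⟩ := digits_of_level hp5 b hb hwin hN hxp (L := 5) (by omega) (by omega)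
    (hcen x hxp (by omega) hself) typeExp_eP6 (i₀ := 2) (by norm_num) (by decide) (he_of_six e0 e1 e2 e3 e4 e5) hg0
  have hg1 : padicNorm p (gHat b p (3 * (t * n) + 8 * n - (x + 5 * p)) - (-g)) ≤ (p : ℚ) ^ (-(1 : ℤ)) := by
    rw [sub_neg_eq_add]; exact hconj
  obtain ⟨w2, v2, -, -, -, -⟩ := digits_of_level hp5 b hb hwin hN (x := 3 * (t * n) + 8 * n - (x + 5 * p)) (L := 5)
    (by omega) (by omega) (by omega) (hcen _ (by omega) (by omega) hx'.2.2.2) typeExp_eP6 (i₀ := 2) (by norm_num)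
    (by decide) (he_of_six f0 f1 f2 f3 f4 f5) hg1
  refine ⟨?_, ?_, ?_, ?_⟩
  · have e : (p : ℚ) ^ 5 * (classW b p x + classW b p (3 * (t * n) + 8 * n - (x + 5 * p))) =
        ((p : ℚ) ^ 5 * classW b p x + g * typeW 5 eP6) +
          ((p : ℚ) ^ 5 * classW b p (3 * (t * n) + 8 * n - (x + 5 * p)) + (-g) * typeW 5 eP6) := by ring
    rw [e]; exact small_add w1 w2
  · have e : (p : ℚ) ^ 8 * (classV b p x + classV b p (3 * (t * n) + 8 * n - (x + 5 * p))) =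
        ((p : ℚ) ^ 8 * classV b p x - g * typeV 5 eP6) +
          ((p : ℚ) ^ 8 * classV b p (3 * (t * n) + 8 * n - (x + 5 * p)) - (-g) * typeV 5 eP6) := by ring
    rw [e]; exact small_add v1 v2
  · have e : (p : ℚ) ^ 5 * classW b p x = ((p : ℚ) ^ 5 * classW b p x + g * typeW 5 eP6) - g * typeW 5 eP6 := by ring
    rw [e]; exact nI_sub (nI_of_small w1) (padicNorm_mul_le_one ig iw1)
  · have e : (p : ℚ) ^ 8 * classV b p x = ((p : ℚ) ^ 8 * classV b p x - g * typeV 5 eP6) + g * typeV 5 eP6 := by ring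
    rw [e]; exact nI_add (nI_of_small v1) (padicNorm_mul_le_one ig iv1)

end MinBlock

end Summit.KontsevichZagierPeriods.Zeta5Search.CellD

end
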